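import Literature.NumberTheory.LFunctions.PsdDyadicCertificate
import HarnessLib

/-!
# Format C, design C∞ (E2 data side): the REAL stage objects of the ODD-sector certificate matrix, over abstract primitives

Route context: Fourier–Galerkin / Schur-complement certificates of Weil positivity on a window ("format C", C∞ door;
cell memo `run/shared/lean/pub/rh-explicit/rh-explicit-weil-2/gen15/E2-PLAN-v2.md` §6 and the gen16 layout of record,
HOME STATUS 2026-08-25 «weil-2 gen16 STATUS 0»; supporting stmt-RiemannHypothesis-0098; seat rh-explicit-weil-2).

The certificate door `WeilFormatC.weilPositivityOn_of_cinf_cert` (`WeilFormatCCinfDoorCert`) asks, for the odd sector,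
four families of entry enclosures `hxxo hxβo hβxo hββo` of the explicit matrix `S − δ·1` on `Fin Bo ⊕ Fin ro` printed in
its statement (kernel index `k` ↔ mode `k+1`).  Every entry is a finite expression in PRIMITIVE objects — the sector kernel `Kb n m`, the profile Fourier
values `Fc j n` over `√(2a)`, the resolved images `Xr j m`, the profile entries `Pf`, `Ip`, the fiber sums `Prow Pimg Rtab`,
the Hankel data `Ge ce`, the remainders `ρrow ρimg`, and the generator's own rationals `coef wmid Λ1 Λ2 θ We d₁`.
This file is the odd twin of `WeilFormatCCinfCertStagesEven`: over ABSTRACT primitives of the door's types (block `Fin B`,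
`B = Bo`; profiles `Fin r`; families `ι = Fin 4 × Fin D`; `Kb n m` = odd sector kernel at kernel indices, `Fc j n = Im ĉ_{n+1}(1f_j)`,
`Xr j m = Im W(1f_j, χ⁻_{m+1})/√2`), the real STAGE OBJECTS of the composite evaluator:

* `CinfStageO.VR` (Fourier table value `2·Fc/√(2a)`), `gxR / gbR` (resolved middle columns), `AxR / AbR` (family matrix rows),
  `TxxR …` (middle Gram), `HxxR …` (Hankel quadratic part), `ER` (Parseval table), `CxR` (resolved cross entry + free map),
  `PbbR / L2R` (profile block), `RtotR / rtilR` (remainder weights), and the four block entries `SxxR SxbR SbxR SbbR`;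
* `CinfStageO.SR` — the blocks glued into ONE `ℕ`-indexed function on `[0, B+r)²` (x-indices first), the object the
  integer stages enclose (`CinfExact.TabNear (SR …) (B+r) (B+r) cS ρS SZ`), with the four readers `SR_xx/xb/bx/bb`.

Written so that, with the door's printed primitives substituted for the abstract heads, `SxxR i i' − [i=i']δ` etc. unfold
(`dsimp only`) to the door's four odd formulas verbatim (`WeilFormatCCinfCertOdd`).  Definitions only (+ `rfl` readers);
standard axioms; no RH claim.
-/

set_option autoImplicit false
-- `Summit.RiemannHypothesis.RiemannHypothesis.…` is the layout-mandated namespace (summit = problem name).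
set_option linter.dupNamespace false

open Finset

noncomputable section

namespace Summit.RiemannHypothesis.RiemannHypothesis.Theorems.WeilFormatC

namespace CinfStageO

variable {r D : ℕ}

/-! ## Primitive-level objects -/

/-- The odd V-table value `V_j(k) = 2·Fc j k / √(2a)` (`Fc j k = Im ĉ_{k+1}(1·f_j)`, `sq = √(2a)`). -/
def VR (Fc : Fin r → ℕ → ℝ) (sq : ℝ) (j : Fin r) (n : ℕ) : ℝ :=
  2 * Fc j n / sq

/-- The Parseval table `E(j₀,j₁) = 2 Re∫1f_{j₀}·conj 1f_{j₁} − Σ_{k<Bo} V V` as printed in the door (odd). -/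
def ER (B : ℕ) (Fc : Fin r → ℕ → ℝ) (sq : ℝ) (Ip : Fin r → Fin r → ℝ) (j₀ j₁ : Fin r) : ℝ :=
  2 * Ip j₀ j₁ - ∑ k ∈ Finset.range B, (2 * Fc j₀ k / sq) * (2 * Fc j₁ k / sq)

/-! ## Resolved middle columns (modes `m ∈ [B, m₀)`) -/

/-- x-part of the resolved middle column: `Kb i m − Σ_j V_j(m) Λ1(j,i)`. -/
def gxR (B : ℕ) (Kb : ℕ → ℕ → ℝ) (Fc : Fin r → ℕ → ℝ) (sq : ℝ) (Λ1 : Fin r → Fin B → ℝ) (i : Fin B) (m : ℕ) : ℝ :=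
  Kb i m - ∑ j, VR Fc sq j m * Λ1 j i

/-- β-part of the resolved middle column: `(Xr j₁ m − Σ_{n<B} Kb n m V_{j₁}(n)) − Σ_j V_j(m) Λ2(j,j₁)`. -/
def gbR (B : ℕ) (Kb : ℕ → ℕ → ℝ) (Fc : Fin r → ℕ → ℝ) (sq : ℝ) (Xr : Fin r → ℕ → ℝ) (Λ2 : Fin r → Fin r → ℝ)
    (j₁ : Fin r) (m : ℕ) : ℝ :=
  (Xr j₁ m - ∑ n ∈ Finset.Ico 0 B, Kb n m * VR Fc sq j₁ n) - ∑ j, VR Fc sq j m * Λ2 j j₁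

/-! ## Family-matrix rows (`ι = Fin 4 × Fin D`) -/

/-- x-row of the family matrix: `Prow i f − Σ_j Rtab j f Λ1 j i`. -/
def AxR (B : ℕ) (Prow : ℕ → Fin 4 × Fin D → ℝ) (Rtab : Fin r → Fin 4 × Fin D → ℝ) (Λ1 : Fin r → Fin B → ℝ)
    (i : Fin B) (f : Fin 4 × Fin D) : ℝ :=
  Prow i f - ∑ j, Rtab j f * Λ1 j i

/-- β-row of the family matrix: `(Σ_{q∈se} coef j₁ q Pimg q f − Σ_{n<B} V_{j₁}(n) Prow n f) − Σ_j Rtab j f Λ2 j j₁`. -/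
def AbR (B : ℕ) (se : Finset ℕ) (coef : Fin r → ℕ → ℝ) (Fc : Fin r → ℕ → ℝ) (sq : ℝ)
    (Prow Pimg : ℕ → Fin 4 × Fin D → ℝ) (Rtab : Fin r → Fin 4 × Fin D → ℝ) (Λ2 : Fin r → Fin r → ℝ)
    (j₁ : Fin r) (f : Fin 4 × Fin D) : ℝ :=
  (∑ q ∈ se, coef j₁ q * Pimg q f - ∑ n ∈ Finset.Ico 0 B, VR Fc sq j₁ n * Prow n f) - ∑ j, Rtab j f * Λ2 j j₁

/-! ## Middle Gram (four blocks) -/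

section Blocks

variable (B : ℕ) (Kb : ℕ → ℕ → ℝ) (Fc : Fin r → ℕ → ℝ) (sq : ℝ) (Xr : Fin r → ℕ → ℝ)
  (Pf Ip : Fin r → Fin r → ℝ) (se : Finset ℕ) (coef : Fin r → ℕ → ℝ)
  (Prow Pimg : ℕ → Fin 4 × Fin D → ℝ) (Rtab : Fin r → Fin 4 × Fin D → ℝ) (ρrow ρimg : ℕ → ℝ)
  (Ge : Fin 4 × Fin D → Fin 4 × Fin D → ℝ) (ce : Fin 4 × Fin D → ℝ) (wmid : ℕ → ℝ)
  (Λ1 : Fin r → Fin B → ℝ) (Λ2 : Fin r → Fin r → ℝ) (m₀ : ℕ) (θ We d₁ : ℝ)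

/-- Middle Gram, (x,x). -/
def TxxR (i i' : Fin B) : ℝ :=
  ∑ m ∈ Finset.Ico B m₀, gxR B Kb Fc sq Λ1 i m * gxR B Kb Fc sq Λ1 i' m / wmid m

/-- Middle Gram, (x,β). -/
def TxbR (i : Fin B) (j₁ : Fin r) : ℝ :=
  ∑ m ∈ Finset.Ico B m₀, gxR B Kb Fc sq Λ1 i m * gbR B Kb Fc sq Xr Λ2 j₁ m / wmid m

/-- Middle Gram, (β,x). -/
def TbxR (j₁ : Fin r) (i : Fin B) : ℝ :=
  ∑ m ∈ Finset.Ico B m₀, gbR B Kb Fc sq Xr Λ2 j₁ m * gxR B Kb Fc sq Λ1 i m / wmid m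

/-- Middle Gram, (β,β). -/
def TbbR (j₁ j₂ : Fin r) : ℝ :=
  ∑ m ∈ Finset.Ico B m₀, gbR B Kb Fc sq Xr Λ2 j₁ m * gbR B Kb Fc sq Xr Λ2 j₂ m / wmid m

/-! ## Hankel quadratic part (four blocks) -/

/-- Hankel part, (x,x): `ΣΣ Ax Ax' Ge + Σ ce Ax Ax'`. -/
def HxxR (i i' : Fin B) : ℝ :=
  (∑ f, ∑ f', (AxR B Prow Rtab Λ1 i f) * (AxR B Prow Rtab Λ1 i' f') * Ge f f')
    + ∑ f, ce f * (AxR B Prow Rtab Λ1 i f) * (AxR B Prow Rtab Λ1 i' f)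

/-- Hankel part, (x,β). -/
def HxbR (i : Fin B) (j₁ : Fin r) : ℝ :=
  (∑ f, ∑ f', (AxR B Prow Rtab Λ1 i f) * (AbR B se coef Fc sq Prow Pimg Rtab Λ2 j₁ f') * Ge f f')
    + ∑ f, ce f * (AxR B Prow Rtab Λ1 i f) * (AbR B se coef Fc sq Prow Pimg Rtab Λ2 j₁ f)

/-- Hankel part, (β,x). -/
def HbxR (j₁ : Fin r) (i : Fin B) : ℝ :=
  (∑ f, ∑ f', (AbR B se coef Fc sq Prow Pimg Rtab Λ2 j₁ f) * (AxR B Prow Rtab Λ1 i f') * Ge f f')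
    + ∑ f, ce f * (AbR B se coef Fc sq Prow Pimg Rtab Λ2 j₁ f) * (AxR B Prow Rtab Λ1 i f)

/-- Hankel part, (β,β). -/
def HbbR (j₁ j₂ : Fin r) : ℝ :=
  (∑ f, ∑ f', (AbR B se coef Fc sq Prow Pimg Rtab Λ2 j₁ f) * (AbR B se coef Fc sq Prow Pimg Rtab Λ2 j₂ f') * Ge f f')
    + ∑ f, ce f * (AbR B se coef Fc sq Prow Pimg Rtab Λ2 j₁ f) * (AbR B se coef Fc sq Prow Pimg Rtab Λ2 j₂ f)

/-! ## Remainder weights, cross and profile blocks -/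

/-- Total remainder weight `Σ_i ρrow i + Σ_j (Σ_{q∈se}|coef j q| ρimg q + Σ_{n<B} |V_j(n)| ρrow n)`. -/
def RtotR : ℝ :=
  ∑ i : Fin B, ρrow i
    + ∑ j : Fin r, (∑ q ∈ se, |coef j q| * ρimg q + ∑ n ∈ Finset.Ico 0 B, |VR Fc sq j n| * ρrow n)

/-- Profile remainder weight `ρ̃(j₁) = Σ_{q∈se}|coef j₁ q| ρimg q + Σ_{n<B} |V_{j₁}(n)| ρrow n`. -/
def rtilR (j₁ : Fin r) : ℝ :=
  ∑ q ∈ se, |coef j₁ q| * ρimg q + ∑ n ∈ Finset.Ico 0 B, |VR Fc sq j₁ n| * ρrow n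

/-- Resolved cross entry plus the free-map correction:
`(Xr j₁ i − Σ_{n<B} Kb n i V_{j₁}(n)) + (Λ1 j₁ i − Σ_{j₀} Λ1 j₀ i E(j₀,j₁))`. -/
def CxR (i : Fin B) (j₁ : Fin r) : ℝ :=
  (Xr j₁ i - ∑ n ∈ Finset.Ico 0 B, Kb n i * VR Fc sq j₁ n)
    + (Λ1 j₁ i - ∑ j₀, Λ1 j₀ i * ER B Fc sq Ip j₀ j₁)

/-- Resolved profile entry `Pf − Σ V₂X₁ − Σ V₁X₂ + Σ_n V₂(n) Σ_{n'} Kb n' n V₁(n')`. -/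
def PbbR (j₁ j₂ : Fin r) : ℝ :=
  Pf j₁ j₂
    - ∑ n ∈ Finset.Ico 0 B, VR Fc sq j₂ n * Xr j₁ n
    - ∑ n ∈ Finset.Ico 0 B, VR Fc sq j₁ n * Xr j₂ n
    + ∑ n ∈ Finset.Ico 0 B, VR Fc sq j₂ n * ∑ n' ∈ Finset.Ico 0 B, Kb n' n * VR Fc sq j₁ n'

/-- Free-map correction of the profile block `Λ2 j₂ j₁ + Λ2 j₁ j₂ − Σ Λ2 j₀ j₁ E(j₀,j₂) − Σ Λ2 j₀ j₂ E(j₀,j₁)`. -/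
def L2R (j₁ j₂ : Fin r) : ℝ :=
  Λ2 j₂ j₁ + Λ2 j₁ j₂ - ∑ j₀, Λ2 j₀ j₁ * ER B Fc sq Ip j₀ j₂ - ∑ j₀, Λ2 j₀ j₂ * ER B Fc sq Ip j₀ j₁

/-! ## The four block entries of `S` (before `−δ·1`) -/

/-- `S(x,x)`. -/
def SxxR (i i' : Fin B) : ℝ :=
  Kb i i'
    - (TxxR B Kb Fc sq wmid Λ1 m₀ i i'
      + (((1 + θ) * HxxR B Prow Rtab Ge ce Λ1 i i'
          + (1 + 1 / θ) * (We * RtotR B Fc sq se coef ρrow ρimg) * (if i = i' then ρrow i else 0)) / d₁))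

/-- `S(x,β)`. -/
def SxbR (i : Fin B) (j₁ : Fin r) : ℝ :=
  CxR B Kb Fc sq Xr Ip Λ1 i j₁
    - (TxbR B Kb Fc sq Xr wmid Λ1 Λ2 m₀ i j₁
      + (1 + θ) * HxbR B Fc sq se coef Prow Pimg Rtab Ge ce Λ1 Λ2 i j₁ / d₁)

/-- `S(β,x)`. -/
def SbxR (j₁ : Fin r) (i : Fin B) : ℝ :=
  CxR B Kb Fc sq Xr Ip Λ1 i j₁
    - (TbxR B Kb Fc sq Xr wmid Λ1 Λ2 m₀ j₁ i
      + (1 + θ) * HbxR B Fc sq se coef Prow Pimg Rtab Ge ce Λ1 Λ2 j₁ i / d₁)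

/-- `S(β,β)`. -/
def SbbR (j₁ j₂ : Fin r) : ℝ :=
  (PbbR B Kb Fc sq Xr Pf j₁ j₂ + L2R B Fc sq Ip Λ2 j₁ j₂)
    - (TbbR B Kb Fc sq Xr wmid Λ2 m₀ j₁ j₂
      + (((1 + θ) * HbbR B Fc sq se coef Prow Pimg Rtab Ge ce Λ2 j₁ j₂
          + (1 + 1 / θ) * (We * RtotR B Fc sq se coef ρrow ρimg)
            * (if j₁ = j₂ then rtilR B Fc sq se coef ρrow ρimg j₁ else 0)) / d₁))

/-- **The glued `ℕ`-indexed matrix** on `[0, B + r)²`, x-indices first (`0` beyond). -/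
def SR (p p' : ℕ) : ℝ :=
  if hp : p < B then
    (if hp' : p' < B then
      SxxR B Kb Fc sq se coef Prow Rtab ρrow ρimg Ge ce wmid Λ1 m₀ θ We d₁ ⟨p, hp⟩ ⟨p', hp'⟩
    else if hq' : p' - B < r then
      SxbR B Kb Fc sq Xr Ip se coef Prow Pimg Rtab Ge ce wmid Λ1 Λ2 m₀ θ d₁ ⟨p, hp⟩ ⟨p' - B, hq'⟩
    else 0)
  else if hq : p - B < r then
    (if hp' : p' < B then
      SbxR B Kb Fc sq Xr Ip se coef Prow Pimg Rtab Ge ce wmid Λ1 Λ2 m₀ θ d₁ ⟨p - B, hq⟩ ⟨p', hp'⟩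
    else if hq' : p' - B < r then
      SbbR B Kb Fc sq Xr Pf Ip se coef Prow Pimg Rtab ρrow ρimg Ge ce wmid Λ2 m₀ θ We d₁ ⟨p - B, hq⟩ ⟨p' - B, hq'⟩
    else 0)
  else 0

/-- Reader (x,x). -/
theorem SR_xx (i i' : Fin B) :
    SR B Kb Fc sq Xr Pf Ip se coef Prow Pimg Rtab ρrow ρimg Ge ce wmid Λ1 Λ2 m₀ θ We d₁ i i'
      = SxxR B Kb Fc sq se coef Prow Rtab ρrow ρimg Ge ce wmid Λ1 m₀ θ We d₁ i i' := by
  simp only [SR, dif_pos i.isLt, dif_pos i'.isLt, Fin.eta]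

/-- Reader (x,β). -/
theorem SR_xb (i : Fin B) (j₁ : Fin r) :
    SR B Kb Fc sq Xr Pf Ip se coef Prow Pimg Rtab ρrow ρimg Ge ce wmid Λ1 Λ2 m₀ θ We d₁ i (B + j₁)
      = SxbR B Kb Fc sq Xr Ip se coef Prow Pimg Rtab Ge ce wmid Λ1 Λ2 m₀ θ d₁ i j₁ := by
  have h1 : ¬ (B + (j₁ : ℕ) < B) := by omega
  simp only [SR, dif_pos i.isLt, dif_neg h1, Nat.add_sub_cancel_left, Fin.eta]
  exact dif_pos j₁.isLt

/-- Reader (β,x). -/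
theorem SR_bx (j₁ : Fin r) (i : Fin B) :
    SR B Kb Fc sq Xr Pf Ip se coef Prow Pimg Rtab ρrow ρimg Ge ce wmid Λ1 Λ2 m₀ θ We d₁ (B + j₁) i
      = SbxR B Kb Fc sq Xr Ip se coef Prow Pimg Rtab Ge ce wmid Λ1 Λ2 m₀ θ d₁ j₁ i := by
  have h1 : ¬ (B + (j₁ : ℕ) < B) := by omega
  simp only [SR, dif_pos i.isLt, dif_neg h1, Nat.add_sub_cancel_left, Fin.eta]
  exact dif_pos j₁.isLt

/-- Reader (β,β). -/
theorem SR_bb (j₁ j₂ : Fin r) :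
    SR B Kb Fc sq Xr Pf Ip se coef Prow Pimg Rtab ρrow ρimg Ge ce wmid Λ1 Λ2 m₀ θ We d₁ (B + j₁) (B + j₂)
      = SbbR B Kb Fc sq Xr Pf Ip se coef Prow Pimg Rtab ρrow ρimg Ge ce wmid Λ2 m₀ θ We d₁ j₁ j₂ := by
  have h1 : ¬ (B + (j₁ : ℕ) < B) := by omega
  have h3 : ¬ (B + (j₂ : ℕ) < B) := by omega
  simp only [SR, dif_neg h1, dif_neg h3, Nat.add_sub_cancel_left, Fin.eta]
  rw [dif_pos j₁.isLt, dif_pos j₂.isLt]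

end Blocks

end CinfStageO

end Summit.RiemannHypothesis.RiemannHypothesis.Theorems.WeilFormatC

end
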